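import Summits.CriticalPhenomena.SAWScalingLimit.Theses.SAWAsymptoticMorera

/-!
# Line `birth` — registered skeleton for the crux `AsymptoticMorera` (stmt-CriticalPhenomena-6856)

Crux (FIXED; rank 2 of `route-CriticalPhenomena-SAWAsymptoticMorera`, sub-problem `SAWScalingLimit`):
for the critical square-lattice mid-edge parafermion `F_δ` (spin `σ = 5/8`, `x = x_c`, root `a_δ → a`
with outside reference neighbour `a'_δ`) and every `C²` compactly supported `χ` with `tsupport χ ⊆ Ω`,
the smeared discrete `∂̄` of `F_δ` is `o(local L¹ mass)`:

  `∀ ε > 0, ∀ᶠ δ → 0⁺, ‖M δ‖ ≤ ε · N δ`,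
  `M δ = δ² Σ_e F_δ(e) ∂̄χ(m_e)`,  `N δ = δ² Σ_{m_e ∈ tsupport χ} ‖F_δ(e)‖`

(edges `e = {v, v + e_k}`, `k ∈ {0,1}`, of `ℤ²`, each undirected edge once; `m_e` its medial point;
`F_δ(e) = H(v, v+e_k) + H(v+e_k, v)` the symmetrised half-edge terms of the crux).

## The cut — the discrete Hodge / Green split of the distributional `∂̄` on the medial lattice of `ℤ²`

The medial lattice of `ℤ²` has a face around every VERTEX `v` and around every PLAQUETTE `c` of `ℤ²`.
Summation by parts on it is an EXACT identity (finite sums, pure algebra, valid for any edge function):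

  `Σ_v χ(δv)·D(v) + Σ_c χ(δc)·P(c) = − Σ_e F(e)·∇χ(m_e)`,
  `∇χ(m) := [χ(m + δ/2) − χ(m − δ/2)] + i·[χ(m + iδ/2) − χ(m − iδ/2)] = 2δ·∂̄χ(m) + r(m)`,
  `|r(m)| ≤ ‖D²χ‖_∞ δ²/2`, `r` supported in the `δ/2`-collar of `tsupport χ`,

where `D(v) = Σ_{j<4} i^j F({v, v + i^j})` is the DCS VERTEX DEFECT at `v` (literally the left-hand side
of the route's support item `Z2VertexIdentity`) and `P(c) = Σ_{j<4} i^j F(edge of c at c + (δ/2) i^j)` is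
the CIRCULATION of `F` around the plaquette `c`. Hence, with `V δ := δ² Σ_v χ(δv) D(v)` and
`P δ := δ² Σ_c χ(δc) P(c)`,

  `2δ·M δ + (V δ + P δ) = −δ² Σ_e F(e) r(m_e)`,   so   `‖2δ·M δ + V δ + P δ‖ ≤ (‖D²χ‖_∞/2)·δ²·N⁺ δ`,

`N⁺ δ := δ² Σ_{m_e ∈ cthickening δ (tsupport χ)} ‖F(e)‖` the mass on the closed `δ`-collar of `supp χ`.
So `AsymptoticMorera` says exactly: the smeared vertex defect PLUS the smeared plaquette circulation is
`o(δ · mass)`. The line proves the two halves separately: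

* S1 `stub_greenTaylor` (size M, deterministic, LANDABLE NOW): the displayed Green–Taylor estimate
  `∃ C, ∀ δ > 0, ‖2δ M δ + (V δ + P δ)‖ ≤ C δ² N⁺ δ` for `χ ∈ C²_c` (finite-support `tsum` bookkeeping over
  `Site 2`, the exact rearrangement above, and the symmetric-difference Taylor bound
  `|χ(m+h) − χ(m−h) − 2Dχ(m)h| ≤ ‖D²χ‖_∞|h|²`).
* S2 `stub_vertexDefect` (HARDEST, open — the heart of DCS Conjecture 2 on `ℤ²`): the smeared vertex
  defect is `o(δ · mass)`: `∀ ε > 0, ∀ᶠ δ, ‖V δ‖ ≤ ε δ N⁺ δ`. By `Z2VertexIdentity` (support item r9,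
  exact, with remainder) `D(v) = (x_c(1 + 2 sin 5π/16) − 1)·Σ_d d·T_d − Σ_d d·L_d`, so S2 IS the statement
  that the smeared `εF♯ − L♯` (type-1 imbalance `ε ≈ 0.0094` and the loop-return terms) is `o(δ·mass)` —
  the crux docstring's own reading; the recorded why-might-fail (the weight-`(5/8,1)` defect field at
  `c = 0`) lives here and only here.
* S3 `stub_plaquetteCirculation` (open, size L–XL): the smeared plaquette circulation is `o(δ · mass)`:
  `∀ ε > 0, ∀ᶠ δ, ‖P δ‖ ≤ ε δ N⁺ δ`. This is "the other half of the discrete Cauchy–Riemann equations in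
  the mean": NO local identity for it exists even on the hexagonal lattice
  (`Literature.Barriers.CriticalPhenomena.ParafermionicHalfCauchyRiemann`), so its mechanism must be
  different from S2's (isotropy / rotation covariance of the edge observable: in any scaling regime
  `F_δ/ρ_δ → f` locally uniformly with the SAME `f` on horizontal and vertical edges, S2 ∧ S3 ⟺
  `∂̄(f_h + f_v) = 0 ∧ ∂(f_h − f_v) = 0`, while the crux alone is `∂̄(f_h + f_v) = 0`).
* S4 `stub_collarMass` (size M given interior regularity; open standalone): the closed `δ`-collar of
  `tsupport χ` carries a bounded share of the mass, `∃ C, ∀ᶠ δ, N⁺ δ ≤ C · N δ`. Any proof of the crux AS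
  TYPED must control this collar (every local identity leaks `δ/2` outside `tsupport χ`, where `N` does
  not look); it follows from the sibling crux `InteriorRegularity` (sup-comparability + relative
  equicontinuity give `N_K ≥ c η² sup_K |F|` and collar mass `≤ C' δ sup_{K'} |F|`), and holds with
  `C = 1 + o(1)` in the expected regime `F_δ/ρ_δ → C·(φ')^{5/8} ≠ 0`.

`AsymptoticMorera_of` (kernel-checked, no `sorry` of its own) is the `ε`-management: from S1–S4,
`‖M δ‖ ≤ (C₁δ/2 + ε₁)·N⁺ δ ≤ (C₁δ/2 + ε₁)·K·N δ ≤ ε·N δ` eventually, with `K = max C₄ 1`,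
`ε₁ = ε/(2K)` and `δ ≤ ε/(K(|C₁|+1))`; it concludes the route decl BY NAME through
`asymptoticMorera_iff : AsymptoticMorera' ↔ AsymptoticMorera := Iff.rfl` (the primed form is the crux with
its four `let`s zeta-reduced into the §1 vocabulary, definitionally equal — the file re-opens the route
file's scopes so that the `if … then … else` instances coincide).

Disproof / negatives used: no `Cruxes/AsymptoticMorera/Disproof.lean` exists (`ledger crux ls
stmt-CriticalPhenomena-6856`: no workfiles, 2026-08-17), so there is no `_false_without_` obstruction to
honour and no landed `Theorems/AsymptoticMorera/Negative/*`; `ledger negatives --problem CriticalPhenomena`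
has no statement about the parafermionic observable's defect (the SAW entries concern all-`δ` tightness,
stmt-0772, not used here: every statement below is eventual in `δ` or pointwise in `δ > 0`).
Vacuity pass: `χ ≡ 0` gives `M = V = P = N = N⁺ = 0` (note `cthickening δ ∅ = ∅`), all stubs true;
`N⁺ ≥ N ≥ 0` always; S1 is an honest finite-dimensional statement for `δ > 0` (all `tsum`s have finite
support: `χ`, `∂̄χ` and the collar indicator are compactly supported); S4 silently asserts `N⁺ δ = 0`
whenever `N δ = 0` (no mass inside `tsupport χ` but some on its collar) — impossible in the expected
regime, recorded as its why-might-fail.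
-/

noncomputable section

-- the route file's scopes, re-opened verbatim so that elaboration (instances of the `if`s, coercions)
-- coincides with the crux's and `asymptoticMorera_iff` below is `Iff.rfl`
open scoped BigOperators Topology Manifold Classical MeasureTheory ProbabilityTheory Matrix InnerProductSpace ComplexConjugate ContinuousMap
open Filter Set Function TopologicalSpace MeasureTheory
open Literature.Probability.RandomPlanarGeometry Literature.Probability.LatticeModels

namespace Summit.CriticalPhenomena.SAWScalingLimit.Cruxes.AsymptoticMorera.Birth

/-! ### 1. Vocabulary — the crux's `let`s as definitions, and the two local defects -/

/-- The crux's half-edge term `H_δ(p, q)`: critical SAWs of `Ω_δ` from the root `a δ` to `p` not having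
used the edge `{p, q}`, continued by the half-edge to the medial point of `{p, q}`, weighted
`e^{-i(5/8)W} x_c^{|γ|+1}` with the winding `W` measured from the outside reference point `δ·a' δ`.
VERBATIM the crux's `let H`. -/
def H (D : DobrushinDomain) (a a' : ℝ → Site 2) (δ : ℝ) (p q : Site 2) : ℂ :=
  ∑' γ : Literature.Probability.RandomPlanarGeometry.SAW.DomainSAW D.carrier δ (a δ) p,
    if s(p, q) ∈ γ.walk.edges then 0 else
      Complex.exp (-Complex.I * (5 / 8 : ℂ) *
          (Literature.Probability.LatticeModels.winding
              (Literature.Probability.LatticeModels.meshPoint δ (a' δ) ::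
                  (γ.walk.support.map (Literature.Probability.LatticeModels.meshPoint δ)) ++
                [Literature.Probability.LatticeModels.medialPoint δ s(p, q)]) : ℝ)) *
        (Literature.Probability.RandomPlanarGeometry.SAW.criticalFugacity : ℂ) ^ (γ.length + 1)

/-- The two positive axis directions `e₀ = (1, 0)`, `e₁ = (0, 1)` of `ℤ²`; VERBATIM the crux's `let dir`. -/
def dir : Fin 2 → Site 2 := ![![1, 0], ![0, 1]]

/-- The symmetrised (undirected) edge observable `F_δ(e) = H_δ(v, v + e_k) + H_δ(v + e_k, v)` at the edge
`e = {v, v + e_k}`, indexed by its lower/left endpoint `v` and its axis `k` (each undirected edge of `ℤ²`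
exactly once, as in the crux's sums). -/
def F (D : DobrushinDomain) (a a' : ℝ → Site 2) (δ : ℝ) (v : Site 2) (k : Fin 2) : ℂ :=
  H D a a' δ v (v + dir k) + H D a a' δ (v + dir k) v

/-- The medial point `δ(v + e_k/2)` of the edge `(v, k)`. -/
def mpt (δ : ℝ) (v : Site 2) (k : Fin 2) : ℂ :=
  Literature.Probability.LatticeModels.medialPoint δ s(v, v + dir k)

/-- `∂̄χ(z) = (∂ₓχ + i ∂_yχ)(z)/2`, through the real Fréchet derivative; VERBATIM the crux's expression. -/
def dbar (χ : ℂ → ℂ) (z : ℂ) : ℂ :=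
  (fderiv ℝ χ z 1 + Complex.I * fderiv ℝ χ z Complex.I) / 2

/-- The crux's `M δ = δ² Σ_e F_δ(e) ∂̄χ(m_e)` (smeared discrete distributional `∂̄` of `F_δ`). -/
def M (D : DobrushinDomain) (a a' : ℝ → Site 2) (χ : ℂ → ℂ) (δ : ℝ) : ℂ :=
  (δ : ℂ) ^ 2 * ∑' v : Site 2, ∑ k : Fin 2, F D a a' δ v k * dbar χ (mpt δ v k)

/-- The crux's `N δ = δ² Σ_{m_e ∈ tsupport χ} ‖F_δ(e)‖` (local `L¹` mass on the support of `χ`). -/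
def N (D : DobrushinDomain) (a a' : ℝ → Site 2) (χ : ℂ → ℂ) (δ : ℝ) : ℝ :=
  δ ^ 2 * ∑' v : Site 2, ∑ k : Fin 2, (if mpt δ v k ∈ tsupport χ then ‖F D a a' δ v k‖ else 0)

/-- The COLLARED mass `N⁺ δ = δ² Σ_{m_e ∈ cthickening δ (tsupport χ)} ‖F_δ(e)‖`: the local `L¹` mass on
the closed `δ`-neighbourhood of `tsupport χ` (`N⁺ ≥ N`; `cthickening δ ∅ = ∅`). Every local identity on
the lattice moves mass by `δ/2`, so this is the mass the Green–Taylor remainder and the two defects see. -/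
def Nplus (D : DobrushinDomain) (a a' : ℝ → Site 2) (χ : ℂ → ℂ) (δ : ℝ) : ℝ :=
  δ ^ 2 * ∑' v : Site 2, ∑ k : Fin 2,
    (if mpt δ v k ∈ Metric.cthickening δ (tsupport χ) then ‖F D a a' δ v k‖ else 0)

/-- The DCS VERTEX DEFECT of `F_δ` at the vertex `v`: `Σ_{j<4} i^j F({v, v + i^j})`
`= F(v,e₀) + i F(v,e₁) − F(v−e₀,e₀) − i F(v−e₁,e₁)` — literally the left-hand side of the route's
support item `Z2VertexIdentity` (zero on the hexagonal lattice by DCS Lemma 1; on `ℤ²` equal to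
`(x_c(1+2 sin 5π/16) − 1)·Σ_d d·T_d − Σ_d d·L_d`). To first order `≈ 2δ·∂̄f(δv)` for `F ≈ f` smooth. -/
def vertexDefect (D : DobrushinDomain) (a a' : ℝ → Site 2) (δ : ℝ) (v : Site 2) : ℂ :=
  F D a a' δ v 0 + Complex.I * F D a a' δ v 1 - F D a a' δ (v - dir 0) 0 -
    Complex.I * F D a a' δ (v - dir 1) 1

/-- The PLAQUETTE CIRCULATION of `F_δ` around the plaquette with lower-left corner `v` (centre
`c = δv + δ(1+i)/2`): `Σ_{j<4} i^j F(edge of the plaquette at c + (δ/2) i^j)`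
`= F(v+e₀,e₁) + i F(v+e₁,e₀) − F(v,e₁) − i F(v,e₀)`. To first order `≈ 2δ·∂̄f(c)` for `F ≈ f` smooth;
no lattice identity controls it (the missing half of discrete Cauchy–Riemann). -/
def plaquetteCirc (D : DobrushinDomain) (a a' : ℝ → Site 2) (δ : ℝ) (v : Site 2) : ℂ :=
  F D a a' δ (v + dir 0) 1 + Complex.I * F D a a' δ (v + dir 1) 0 - F D a a' δ v 1 -
    Complex.I * F D a a' δ v 0

/-- The SMEARED VERTEX DEFECT `V δ = δ² Σ_v χ(δv)·vertexDefect(v)`. -/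
def V (D : DobrushinDomain) (a a' : ℝ → Site 2) (χ : ℂ → ℂ) (δ : ℝ) : ℂ :=
  (δ : ℂ) ^ 2 * ∑' v : Site 2,
    χ (Literature.Probability.LatticeModels.meshPoint δ v) * vertexDefect D a a' δ v

/-- The SMEARED PLAQUETTE CIRCULATION `P δ = δ² Σ_v χ(δv + δ(1+i)/2)·plaquetteCirc(v)` (test function
read at the plaquette centres). -/
def P (D : DobrushinDomain) (a a' : ℝ → Site 2) (χ : ℂ → ℂ) (δ : ℝ) : ℂ :=
  (δ : ℂ) ^ 2 * ∑' v : Site 2,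
    χ (Literature.Probability.LatticeModels.meshPoint δ v + (δ : ℂ) * (1 + Complex.I) / 2) *
      plaquetteCirc D a a' δ v

/-- The crux's admissibility of the root data, first clause (eventually in `δ`: the root is a vertex of
`Ω_δ`, the reference site is its lattice neighbour and lies outside `Ω`); VERBATIM. -/
def RootAdmissible (D : DobrushinDomain) (a a' : ℝ → Site 2) : Prop :=
  ∀ᶠ δ in nhdsWithin 0 (Set.Ioi 0),
    a δ ∈ Literature.Probability.LatticeModels.meshDomain D.carrier δ ∧
      (Literature.Probability.LatticeModels.zdGraph 2).Adj (a δ) (a' δ) ∧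
        Literature.Probability.LatticeModels.meshPoint δ (a' δ) ∉ D.carrier

/-- The crux's admissibility of the root data, second clause (`δ·a δ → a = D.pt 0`); VERBATIM. -/
def RootTendsto (D : DobrushinDomain) (a : ℝ → Site 2) : Prop :=
  Filter.Tendsto (fun δ => Literature.Probability.LatticeModels.meshPoint δ (a δ))
    (nhdsWithin 0 (Set.Ioi 0)) (nhds (D.pt 0))

/-! ### 2. The four statements of the line, named -/

/-- **S1, named — the Green–Taylor reduction** (deterministic, every `δ > 0`): for `χ ∈ C²_c`,
`‖2δ·M δ + (V δ + P δ)‖ ≤ C·δ²·N⁺ δ` with `C` independent of `δ` (`C = ‖D²χ‖_∞/2` works): the exact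
medial-lattice summation by parts `V + P = −δ² Σ_e F(e)∇χ(m_e)` plus the symmetric-difference Taylor
bound `|∇χ(m) − 2δ ∂̄χ(m)| ≤ ‖D²χ‖_∞ δ²/2`, the remainder living on the `δ/2`-collar of `tsupport χ`. -/
def GreenTaylor : Prop :=
  ∀ (D : DobrushinDomain) (a a' : ℝ → Site 2) (χ : ℂ → ℂ), ContDiff ℝ 2 χ → HasCompactSupport χ →
    ∃ C : ℝ, ∀ δ : ℝ, 0 < δ →
      ‖2 * (δ : ℂ) * M D a a' χ δ + (V D a a' χ δ + P D a a' χ δ)‖ ≤ C * δ ^ 2 * Nplus D a a' χ δ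

/-- **S2, named — the smeared vertex defect is `o(δ · mass)`** (the heart of the crux). -/
def VertexDefectVanishes : Prop :=
  ∀ (D : DobrushinDomain) (a a' : ℝ → Site 2) (χ : ℂ → ℂ), RootAdmissible D a a' → RootTendsto D a →
    ContDiff ℝ 2 χ → HasCompactSupport χ → tsupport χ ⊆ D.carrier →
    ∀ ε > 0, ∀ᶠ δ in nhdsWithin 0 (Set.Ioi 0), ‖V D a a' χ δ‖ ≤ ε * δ * Nplus D a a' χ δ

/-- **S3, named — the smeared plaquette circulation is `o(δ · mass)`** (the other half of discrete
Cauchy–Riemann, in the mean). -/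
def PlaquetteCirculationVanishes : Prop :=
  ∀ (D : DobrushinDomain) (a a' : ℝ → Site 2) (χ : ℂ → ℂ), RootAdmissible D a a' → RootTendsto D a →
    ContDiff ℝ 2 χ → HasCompactSupport χ → tsupport χ ⊆ D.carrier →
    ∀ ε > 0, ∀ᶠ δ in nhdsWithin 0 (Set.Ioi 0), ‖P D a a' χ δ‖ ≤ ε * δ * Nplus D a a' χ δ

/-- **S4, named — the `δ`-collar of `tsupport χ` carries a bounded share of the mass**, eventually. -/
def CollarMass : Prop :=
  ∀ (D : DobrushinDomain) (a a' : ℝ → Site 2) (χ : ℂ → ℂ), RootAdmissible D a a' → RootTendsto D a →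
    ContDiff ℝ 2 χ → HasCompactSupport χ → tsupport χ ⊆ D.carrier →
    ∃ C : ℝ, ∀ᶠ δ in nhdsWithin 0 (Set.Ioi 0), Nplus D a a' χ δ ≤ C * N D a a' χ δ

/-- The crux with its four `let`s zeta-reduced into the §1 vocabulary (definitionally the route decl,
see `asymptoticMorera_iff`). -/
def AsymptoticMorera' : Prop :=
  ∀ (D : DobrushinDomain) (a a' : ℝ → Site 2) (χ : ℂ → ℂ),
    (∀ᶠ δ in nhdsWithin 0 (Set.Ioi 0),
        a δ ∈ Literature.Probability.LatticeModels.meshDomain D.carrier δ ∧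
          (Literature.Probability.LatticeModels.zdGraph 2).Adj (a δ) (a' δ) ∧
            Literature.Probability.LatticeModels.meshPoint δ (a' δ) ∉ D.carrier) →
      Filter.Tendsto (fun δ => Literature.Probability.LatticeModels.meshPoint δ (a δ))
          (nhdsWithin 0 (Set.Ioi 0)) (nhds (D.pt 0)) →
        ContDiff ℝ 2 χ → HasCompactSupport χ → tsupport χ ⊆ D.carrier →
          ∀ ε > 0, ∀ᶠ δ in nhdsWithin 0 (Set.Ioi 0), ‖M D a a' χ δ‖ ≤ ε * N D a a' χ δ

/-- The primed form IS the route decl: `AsymptoticMorera` unfolds (delta, then zeta on `H`, `dir`, `M`,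
`N`, then delta on the §1 vocabulary) to `AsymptoticMorera'`. -/
theorem asymptoticMorera_iff :
    AsymptoticMorera' ↔
      Summit.CriticalPhenomena.SAWScalingLimit.Theses.SAWAsymptoticMorera.AsymptoticMorera :=
  Iff.rfl

/-! ### 3. The registered stubs (the ONLY `sorry`s of this file) -/

/-- **S1 — Green–Taylor reduction** (size M; deterministic discrete calculus, landable now): for every
Dobrushin domain, root data and `χ ∈ C²_c` there is `C` with
`‖2δ·M δ + (V δ + P δ)‖ ≤ C δ² N⁺ δ` for all `δ > 0`. Proof sketch: all `tsum`s over `Site 2` have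
finite support for `δ > 0`; regroup `V + P` edge by edge (coefficient of `F(e)` is `−∇χ(m_e)`, checked
for both axes in `Lines/birth.md`); Taylor with `‖iteratedFDeriv ℝ 2 χ‖ ≤ K`:
`|χ(m+h) − χ(m−h) − 2 Dχ(m) h| ≤ K|h|²` at `h = δ/2, iδ/2`; the remainder vanishes unless
`infDist m_e (tsupport χ) ≤ δ/2`. -/
theorem stub_greenTaylor :
    ∀ (D : DobrushinDomain) (a a' : ℝ → Site 2) (χ : ℂ → ℂ), ContDiff ℝ 2 χ → HasCompactSupport χ →
      ∃ C : ℝ, ∀ δ : ℝ, 0 < δ →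
        ‖2 * (δ : ℂ) * M D a a' χ δ + (V D a a' χ δ + P D a a' χ δ)‖ ≤
          C * δ ^ 2 * Nplus D a a' χ δ := by
  sorry

/-- **S2 (HARDEST) — the smeared DCS vertex defect is `o(δ · mass)`**: for admissible root data and
`χ ∈ C²_c(Ω)`, `∀ ε > 0, ∀ᶠ δ → 0⁺, ‖V δ‖ ≤ ε δ N⁺ δ`. Through `Z2VertexIdentity` this is the statement
that the smeared generator `εF♯ − L♯` (type-1 imbalance, `ε = x_c(1+2 sin 5π/16) − 1 ≈ 0.0094`, and the
signed loop-return terms) is `o(δ · mass)`: the open heart of DCS Conjecture 2 on `ℤ²`. -/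
theorem stub_vertexDefect :
    ∀ (D : DobrushinDomain) (a a' : ℝ → Site 2) (χ : ℂ → ℂ), RootAdmissible D a a' → RootTendsto D a →
      ContDiff ℝ 2 χ → HasCompactSupport χ → tsupport χ ⊆ D.carrier →
      ∀ ε > 0, ∀ᶠ δ in nhdsWithin 0 (Set.Ioi 0),
        ‖V D a a' χ δ‖ ≤ ε * δ * Nplus D a a' χ δ := by
  sorry

/-- **S3 — the smeared plaquette circulation is `o(δ · mass)`**: for admissible root data and
`χ ∈ C²_c(Ω)`, `∀ ε > 0, ∀ᶠ δ → 0⁺, ‖P δ‖ ≤ ε δ N⁺ δ`. No local lattice identity bears on it (not even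
on the hexagonal lattice: the half-Cauchy–Riemann barrier); expected through isotropy of the edge
observable across the two axes in the scaling regime. -/
theorem stub_plaquetteCirculation :
    ∀ (D : DobrushinDomain) (a a' : ℝ → Site 2) (χ : ℂ → ℂ), RootAdmissible D a a' → RootTendsto D a →
      ContDiff ℝ 2 χ → HasCompactSupport χ → tsupport χ ⊆ D.carrier →
      ∀ ε > 0, ∀ᶠ δ in nhdsWithin 0 (Set.Ioi 0),
        ‖P D a a' χ δ‖ ≤ ε * δ * Nplus D a a' χ δ := by
  sorry

/-- **S4 — collar mass**: for admissible root data and `χ ∈ C²_c(Ω)` there is `C` with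
`N⁺ δ ≤ C · N δ` eventually as `δ → 0⁺` (the closed `δ`-collar of `tsupport χ`, `O(1/δ)` edges against
`O(1/δ²)`, carries a bounded share of the local mass). Follows from sup-comparability and relative
equicontinuity of `F_δ` on compacts (the sibling crux `InteriorRegularity`); why it might fail: it
asserts `N⁺ δ = 0` whenever `N δ = 0`. -/
theorem stub_collarMass :
    ∀ (D : DobrushinDomain) (a a' : ℝ → Site 2) (χ : ℂ → ℂ), RootAdmissible D a a' → RootTendsto D a →
      ContDiff ℝ 2 χ → HasCompactSupport χ → tsupport χ ⊆ D.carrier →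
      ∃ C : ℝ, ∀ᶠ δ in nhdsWithin 0 (Set.Ioi 0), Nplus D a a' χ δ ≤ C * N D a a' χ δ := by
  sorry

/-! ### Consistency: each named statement IS its registered stub (definitionally) -/

theorem greenTaylor_holds : GreenTaylor := stub_greenTaylor
theorem vertexDefectVanishes_holds : VertexDefectVanishes := stub_vertexDefect
theorem plaquetteCirculationVanishes_holds : PlaquetteCirculationVanishes := stub_plaquetteCirculation
theorem collarMass_holds : CollarMass := stub_collarMass

/-! ### Name-keyed aliases of the four statements — the hypotheses of `AsymptoticMorera_of`

The skeleton audit (`#h21_check_skeleton`) admits a hypothesis of the skeleton theorem only if its head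
constant is a registered obligation or is NAMED like a declared stub; `__Registered.stub_X` is the statement
of `stub_X` under that name (device of `Cruxes/AxiomsOfLimit/Lines/birth.lean`; the `__` namespace is an
implementation detail, so the audit's stub report resolves each `stub_…` to the sorried theorem, not to the
alias; the gate-reserved `@[stub]` attribute is not written by a planner). Each alias is `rfl`-equal to its
statement. -/
namespace __Registered

/-- Alias of `GreenTaylor` keyed by the registered stub name. -/
abbrev stub_greenTaylor : Prop := GreenTaylor
/-- Alias of `VertexDefectVanishes` keyed by the registered stub name. -/
abbrev stub_vertexDefect : Prop := VertexDefectVanishes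
/-- Alias of `PlaquetteCirculationVanishes` keyed by the registered stub name. -/
abbrev stub_plaquetteCirculation : Prop := PlaquetteCirculationVanishes
/-- Alias of `CollarMass` keyed by the registered stub name. -/
abbrev stub_collarMass : Prop := CollarMass

end __Registered

/-! ### 4. The sorry-free part: mass facts and the composition -/

/-- The local mass `N δ` is non-negative. -/
theorem N_nonneg (D : DobrushinDomain) (a a' : ℝ → Site 2) (χ : ℂ → ℂ) (δ : ℝ) :
    0 ≤ N D a a' χ δ := by
  unfold N
  refine mul_nonneg (sq_nonneg δ) (tsum_nonneg fun v => Finset.sum_nonneg fun k _ => ?_)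
  split_ifs
  · exact norm_nonneg _
  · exact le_rfl

/-- The collared mass `N⁺ δ` is non-negative. -/
theorem Nplus_nonneg (D : DobrushinDomain) (a a' : ℝ → Site 2) (χ : ℂ → ℂ) (δ : ℝ) :
    0 ≤ Nplus D a a' χ δ := by
  unfold Nplus
  refine mul_nonneg (sq_nonneg δ) (tsum_nonneg fun v => Finset.sum_nonneg fun k _ => ?_)
  split_ifs
  · exact norm_nonneg _
  · exact le_rfl

/-- **The composition in the zeta-reduced form** (no `sorry`): Green–Taylor at constant `C₁`, the two
defects at slack `ε₁ = ε/(2K)`, and the collar bound `N⁺ ≤ K·N` (`K = max C₄ 1`) give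
`‖M δ‖ ≤ (C₁δ/2 + ε₁)·K·N δ ≤ ε·N δ` as soon as also `δ ≤ ε/(K(|C₁|+1))`. -/
theorem asymptoticMorera'_of (h1 : GreenTaylor) (h2 : VertexDefectVanishes)
    (h3 : PlaquetteCirculationVanishes) (h4 : CollarMass) : AsymptoticMorera' := by
  intro D a a' χ hroot hlim hχ hsupp hΩ ε hε
  obtain ⟨C₁, hC₁⟩ := h1 D a a' χ hχ hsupp
  obtain ⟨C₄, hC₄⟩ := h4 D a a' χ hroot hlim hχ hsupp hΩ
  -- constants
  set K : ℝ := max C₄ 1 with hK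
  have hK1 : 1 ≤ K := le_max_right _ _
  have hKpos : 0 < K := lt_of_lt_of_le one_pos hK1
  set A : ℝ := |C₁| + 1 with hA
  have hApos : 0 < A := by positivity
  have hC₁A : C₁ ≤ A := le_trans (le_abs_self C₁) (by linarith)
  set ε₁ : ℝ := ε / (2 * K) with hε₁
  have hε₁pos : 0 < ε₁ := by positivity
  set η : ℝ := ε / (K * A) with hη
  have hηpos : 0 < η := by positivity
  -- eventual facts along `𝓝[>] 0`
  have hpos : ∀ᶠ δ in nhdsWithin (0 : ℝ) (Set.Ioi 0), 0 < δ :=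
    eventually_mem_nhdsWithin.mono fun δ hδ => hδ
  have hsmall : ∀ᶠ δ in nhdsWithin (0 : ℝ) (Set.Ioi 0), δ < η :=
    mem_nhdsWithin_of_mem_nhds (Iio_mem_nhds hηpos)
  filter_upwards [hpos, hsmall, h2 D a a' χ hroot hlim hχ hsupp hΩ ε₁ hε₁pos,
    h3 D a a' χ hroot hlim hχ hsupp hΩ ε₁ hε₁pos, hC₄] with δ hδ hδη hV hP hNN
  have hG := hC₁ δ hδ
  -- abbreviations
  have hNp : 0 ≤ Nplus D a a' χ δ := Nplus_nonneg D a a' χ δ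
  have hN : 0 ≤ N D a a' χ δ := N_nonneg D a a' χ δ
  -- the collar bound with the positive constant `K`
  have hNK : Nplus D a a' χ δ ≤ K * N D a a' χ δ :=
    le_trans hNN (mul_le_mul_of_nonneg_right (le_max_left _ _) hN)
  -- ‖2δ M‖ ≤ ‖2δM + (V+P)‖ + ‖V‖ + ‖P‖
  have htri : ‖2 * (δ : ℂ) * M D a a' χ δ‖ ≤
      ‖2 * (δ : ℂ) * M D a a' χ δ + (V D a a' χ δ + P D a a' χ δ)‖ +
        (‖V D a a' χ δ‖ + ‖P D a a' χ δ‖) := by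
    have h := norm_sub_le (2 * (δ : ℂ) * M D a a' χ δ + (V D a a' χ δ + P D a a' χ δ))
      (V D a a' χ δ + P D a a' χ δ)
    rw [add_sub_cancel_right] at h
    exact le_trans h (add_le_add le_rfl (norm_add_le _ _))
  have hnorm2δ : ‖2 * (δ : ℂ) * M D a a' χ δ‖ = 2 * δ * ‖M D a a' χ δ‖ := by
    rw [norm_mul, norm_mul, Complex.norm_real, Real.norm_of_nonneg hδ.le]
    norm_num
  -- hence 2δ‖M‖ ≤ C₁ δ² N⁺ + 2 ε₁ δ N⁺
  have hmain : 2 * δ * ‖M D a a' χ δ‖ ≤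
      C₁ * δ ^ 2 * Nplus D a a' χ δ + 2 * (ε₁ * δ * Nplus D a a' χ δ) := by
    rw [← hnorm2δ]
    linarith [htri, hG, hV, hP]
  -- divide by 2δ: ‖M‖ ≤ (C₁ δ / 2 + ε₁) N⁺
  have hM : ‖M D a a' χ δ‖ ≤ (C₁ * δ / 2 + ε₁) * Nplus D a a' χ δ := by
    have h2δ : 0 < 2 * δ := by positivity
    have : 2 * δ * ‖M D a a' χ δ‖ ≤ 2 * δ * ((C₁ * δ / 2 + ε₁) * Nplus D a a' χ δ) := by
      have hrw : 2 * δ * ((C₁ * δ / 2 + ε₁) * Nplus D a a' χ δ) =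
          C₁ * δ ^ 2 * Nplus D a a' χ δ + 2 * (ε₁ * δ * Nplus D a a' χ δ) := by ring
      rw [hrw]
      exact hmain
    exact le_of_mul_le_mul_left this h2δ
  -- the coefficient is at most ε / K
  have hcoef : C₁ * δ / 2 + ε₁ ≤ ε / K := by
    have hδA : C₁ * δ / 2 ≤ ε / (2 * K) := by
      have h1' : C₁ * δ ≤ A * η := by
        rcases le_or_gt 0 C₁ with hc | hc
        · exact le_trans (mul_le_mul_of_nonneg_left hδη.le hc)
            (mul_le_mul_of_nonneg_right hC₁A hηpos.le)
        · have : C₁ * δ ≤ 0 := mul_nonpos_of_nonpos_of_nonneg hc.le hδ.le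
          exact le_trans this (by positivity)
      have h2' : A * η = ε / K := by
        rw [hη]
        field_simp
      have h3' : C₁ * δ / 2 ≤ (ε / K) / 2 := by linarith
      calc C₁ * δ / 2 ≤ (ε / K) / 2 := h3'
        _ = ε / (2 * K) := by rw [div_div, mul_comm]
    have hsum : ε / (2 * K) + ε / (2 * K) = ε / K := by
      field_simp
      ring
    calc C₁ * δ / 2 + ε₁ ≤ ε / (2 * K) + ε / (2 * K) := by rw [hε₁]; linarith
      _ = ε / K := hsum
  -- final estimate
  calc ‖M D a a' χ δ‖ ≤ (C₁ * δ / 2 + ε₁) * Nplus D a a' χ δ := hM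
    _ ≤ (ε / K) * Nplus D a a' χ δ := mul_le_mul_of_nonneg_right hcoef hNp
    _ ≤ (ε / K) * (K * N D a a' χ δ) :=
        mul_le_mul_of_nonneg_left hNK (div_nonneg hε.le hKpos.le)
    _ = ε * N D a a' χ δ := by
        field_simp

/-! ### 5. The skeleton theorem: the four stubs imply the crux, BY NAME -/

/-- **`AsymptoticMorera` from the line `birth`** (kernel-checked, no `sorry` of its own): hypotheses =
the four stubs under their registered names; conclusion = the route decl, by name. -/
theorem AsymptoticMorera_of (h1 : __Registered.stub_greenTaylor) (h2 : __Registered.stub_vertexDefect)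
    (h3 : __Registered.stub_plaquetteCirculation) (h4 : __Registered.stub_collarMass) :
    Summit.CriticalPhenomena.SAWScalingLimit.Theses.SAWAsymptoticMorera.AsymptoticMorera :=
  asymptoticMorera_iff.mp (asymptoticMorera'_of h1 h2 h3 h4)

/-- Wiring check (an `example`, so that `AsymptoticMorera_of` stays the only theorem concluding the
crux): the registered stubs, with their stated types, feed the skeleton theorem — this term becomes the
crux proof when the four `sorry`s above are discharged. -/
example : Summit.CriticalPhenomena.SAWScalingLimit.Theses.SAWAsymptoticMorera.AsymptoticMorera :=
  AsymptoticMorera_of stub_greenTaylor stub_vertexDefect stub_plaquetteCirculation stub_collarMass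

end Summit.CriticalPhenomena.SAWScalingLimit.Cruxes.AsymptoticMorera.Birth

end
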